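import Mathlib
import Summits.MatrixMultiplication.MatrixMultiplication.Theses.FidelityWitnesses
import Summits.MatrixMultiplication.MatrixMultiplication.Theorems.FidelityWitnessesFidelityThesisSepMajorantTransfer
import Summits.MatrixMultiplication.MatrixMultiplication.Theorems.FidelityWitnessesFidelityThesisStubTrivialMajorant
import Summits.MatrixMultiplication.MatrixMultiplication.Theorems.FidelityThesis.Negative.SummitEquivalence
-- registered stubs of the cycle-2 skeleton, ALL LANDED (imported; statements quoted in comments below):
import Summits.MatrixMultiplication.MatrixMultiplication.Theorems.FidelityWitnessesFidelityThesisStubGeneralMajorantLaw     -- p96754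
import Summits.MatrixMultiplication.MatrixMultiplication.Theorems.FidelityWitnessesFidelityThesisStubFidelityGrowthWindow   -- p96544
import Summits.MatrixMultiplication.MatrixMultiplication.Theorems.FidelityWitnessesFidelityThesisStubGramSchurBound         -- p97607
import Summits.MatrixMultiplication.MatrixMultiplication.Theorems.FidelityWitnessesFidelityThesisStubWeylParseval           -- p98547
import Summits.MatrixMultiplication.MatrixMultiplication.Theorems.FidelityWitnessesFidelityThesisStubParabolaSum            -- p99712
import Summits.MatrixMultiplication.MatrixMultiplication.Theorems.FidelityWitnessesFidelityThesisStubChirpInjectiveNorm     -- (imports the three above)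
-- import Summits.MatrixMultiplication.MatrixMultiplication.Theorems.FidelityWitnessesFidelityThesisChirpRank              -- chirpRank_of_robustnessGrowthAt (lead -1; LANDED, not yet built on the farm snapshot; not needed by the composition)
import Summits.MatrixMultiplication.MatrixMultiplication.Theorems.FidelityWitnessesFidelityThesisStubFidelityGrowthConstOne -- p101433 (lead a1)
import Summits.MatrixMultiplication.MatrixMultiplication.Theorems.FidelityWitnessesFidelityThesisSepMajorantBudgetSplit     -- p103097 (lead a1)
import Summits.MatrixMultiplication.MatrixMultiplication.Theorems.FidelityWitnessesFidelityThesisSepMajorantThreeHalves    -- p94374 (FG at exponent 3/2)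
-- The remaining landed stub files of the line are not needed by the composition (listed for the reader):
-- import Summits.MatrixMultiplication.MatrixMultiplication.Theorems.FidelityWitnessesFidelityThesisStubOrthogonalFrameAdditivity  -- p90260
-- import Summits.MatrixMultiplication.MatrixMultiplication.Theorems.FidelityWitnessesFidelityThesisStubSpectralSplitLaw           -- p92876
-- import Summits.MatrixMultiplication.MatrixMultiplication.Theorems.FidelityWitnessesFidelityThesisStubFrameMajorant               -- p93141
-- (…SepMajorantTransfer imports toolkit I p85852, …StubSeparableMajorantLaw p87201, …StubFrameConditioningLaw p88183.)
import Literature.Computability.AlgebraicComplexity.AlderStrassen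
import Literature.Computability.AlgebraicComplexity.BigCwFourthOmega

/-!
# Line `Sketch` (separable-majorant-law) for crux `FidelityWitnesses.FidelityThesis` (stmt-MatrixMultiplication-4956)

Line lead's OWNED skeleton — cycle 4 (lead c3, prover-line-stmt-MatrixMultiplication-4956-c3-0, 2026-08-16 14:00Z; stubs and
composition byte-identical to lead c2's cycle-3 file, commit 17895e2b8064), continuing leads -0, -1, a1, c2 (`Lines/Sketch.lean`
registered 09:32Z, 10:32Z, 13:41Z, 13:57Z).  STATE: every registered stub except the
load-bearing `stub_fidelityGrowth` has LANDED and is imported below by name; this file has exactly ONE `sorry`.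
VERDICT (lead c3, 2026-08-16 14:02Z): LINE DEAD at `stub_fidelityGrowth` (L5 iii) — the stub is kernel-certified ≥ the crux
(`lineSketch_stub_window` below + `lineSketch_crux_iff_two_lt_omega`: FG(δ′,C) ⟹ 2 + 4δ′/(3−2δ′) ≤ ω(ℂ), crux ⟺ 2 < ω(ℂ) ⟺ ¬summit),
no weakening inside the line exists (p106197, p101433, p103097, p94374), and the equality-point loophole is closed (support-contained:
Loomis–Whitney; general: numerics M(3,4) ≈ 4.00 ≪ 8).  Evidence: `Lines/Sketch-dead.md`.  The file is kept as the record of the line.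
Stubs: closed ⟨stub_generalMajorantLaw p96754, stub_fidelityGrowthWindow p96544, stub_gramSchurBound p97607,
stub_weylParseval p98547, stub_parabolaSum p99712, stub_chirpInjectiveNorm, chirpRank_of_robustnessGrowthAt,
stub_fidelityGrowth_constOne p101433, fidelityGrowth_largeBudget_of_dpd p103097 (+ the 15 of cycles 1–2)⟩ /
open ⟨stub_fidelityGrowth⟩ / delegated ⟨none: one stub left, wave: none⟩ /
STUCK ⟨stub_fidelityGrowth: FG(δ′) ⟹ 2 + 4δ′/(3−2δ′) ≤ ω(ℂ) (landed window), i.e. every admissible instance is ≥ the crux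
⟺ 2 < ω(ℂ); FG ⟺ FG at thin budgets r < n (lead c2, `…SepMajorantThinBudget.lean`) ⟹ DiagonalPowerDecay (stmt-14053) ⟹ crux⟩.

THE CRUX. `FidelityThesis : ∃ δ > 0, ∃ c > 0, ∀ n ≥ 1, ∀ r ≤ c·n^{2+δ}, ∃ ε > 0, ∀ S (tensorRank S ≤ r),
‖Σ S·⟨n,n,n⟩‖² ≤ (1 − ε)·n³·Σ‖S‖²` — by `Cruxes/FidelityThesis/Disproof.lean` (`crux_iff_two_lt_omega`) and the landed
`Theorems/FidelityThesis/Negative/SummitEquivalence` this is EXACTLY `2 < ω(ℂ)`; no line closes it short of that.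

RESHAPE (cycle 2).  The composition now runs through the WEAKER, matrix-multiplication-specific node
  FIDELITY GROWTH FG(δ′, C): `M(n,r) ≤ C·r^{3/2−δ′}` for all `n, r` (`stub_fidelityGrowth`, the ONLY `sorry`)  ⟹  crux
(`fidelityThesis_of_fidelityGrowth`, landed p92236: `δ = 4δ′/(3−2δ′)`, `c = (1/(2C))^{1/(3/2−δ′)}`, `ε = ½`),
instead of through ROBUSTNESS GROWTH RG(δ′, C) (`Λ(r) ≤ C r^{3/2−δ′}`, lead -0's open stub).  RG ⟹ FG is landed
(`fidelityGrowthAt_of_robustnessGrowthAt`), so RG remains a sufficient route, but RG is STRICTLY more than the crux needs: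
this file certifies (kernel-checked modulo the registered stubs below) that
* (window) FG(δ′, C) ⟹ `2 + 4δ′/(3−2δ′) ≤ ω(ℂ)` (`stub_fidelityGrowthWindow`), hence no `δ′ ≥ 0.2358` (tree `ω ≤ 2.37295`);
  the same for RG;
* (T-free law) RG's separable majorant bounds the pairing of a rank-`≤ r` tensor with EVERY test tensor `Z`, by `λ·‖Z‖_σ²`
  (`stub_generalMajorantLaw`; the landed `stub_separableMajorantLaw` is the case `Z = ⟨n,n,n⟩`, `‖Z‖_σ² ≤ 1` = single-product law);
* (explicit tensors) hence RG(δ′, C) ⟹ SUPERLINEAR RANK LOWER BOUNDS for explicit tensors of small injective norm: for the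
  chirp tensors `Z_N = Σ_k e_k ⊗ Z^{k²}X^k` on `ℤ/N` (`N` an odd prime; triage r1-1's named test), whose injective norm² is
  `≤ √(2N−1)` by a Weyl–Parseval / parabola-bijection argument (`stub_gramSchurBound`, `stub_weylParseval`,
  `stub_parabolaSum`, `stub_chirpInjectiveNorm`), one gets `N^{3/2}/(√2·C) ≤ R(Z_N)^{3/2−δ′}`, i.e.
  `R(Z_N) ≥ c·N^{1+δ′/(3/2−δ′)}` (`chirpRank_of_robustnessGrowthAt`, landed separately with its padding/transport helpers) — a
  superlinear rank lower bound for an explicit family OTHER than matrix multiplication.  Such bounds are open in general (the best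
  unconditional bounds for explicit `N×N×N` tensors are linear, `< 3N`), and this one is not known to follow from `ω(ℂ) > 2` (which is
  itself the superlinear bound `R(⟨n,n,n⟩) ≥ n^{2+ε}` in format `N = n²`).  So RG carries a second, MM-free burden; FG does not.
  This is why the line's open stub is now FG, not RG.

THE LINE (card, in tree conventions: slots `a = (κ,ν)` OUTPUT, `b = (κ,μ)`, `c = (μ',ν)` in `Fin n × Fin n`,
`⟨n,n,n⟩(a,b,c) = [a.1 = b.1 ∧ b.2 = c.1 ∧ a.2 = c.2]`); `S = Σ_{l<r} w_l ⊗ u_l ⊗ v_l`; product span `E = span{u_l ⊗ v_l}`.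
Landed (lead -0): toolkit I p85852, SML p87201, FCL p88183, OFA p90260, trivialMajorant p92167, TRANSFER p92236 (RG ⇒ FG ⇒ crux,
FG ⇒ DiagonalPowerDecay, well-conditioned class), spectralSplit p92876, frameMajorant p93141, and FG AT THE CRITICAL EXPONENT
`M(n,r) ≤ r^{3/2}` p94374 (`fidelity_le_rpow_threeHalves`, from six landed components).  So FG holds at exponent `3/2` with
`C = 1`; every exponent below it closes the crux and is ≥ `ω > 2`.

DISPROOF USED (`Cruxes/FidelityThesis/Disproof.lean`, cdisprove cycle 1, re-read 2026-08-16 10:20Z; unchanged since 05:48Z, no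
`-- Targets` section yet): `crux_iff_two_lt_omega`; `crux_false_without_rankBound` (rank bound consumed as "`r` products span
`E`" / `tensorRank S ≤ r` in FG); `crux_false_without_growthBound` (growth bound consumed in the transfer's exponent arithmetic
`(2+δ)(3/2−δ′) = 3`); `not_fidelityThesisAt_of_gt` (δ ≤ 0.37295 ⇒ δ′ < 0.2358, now a tree-level statement about FG/RG:
`not_fidelityGrowthAt_of_ge`); `not_fidelityThesisAt_with_one_le` (c < 1 automatic: `C ≥ M(1,1) = 1`).

STUBS (cycle 2 registration): `stub_fidelityGrowth` (XL, OPEN, load-bearing, the lead's) · `stub_generalMajorantLaw` (M) ·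
`stub_fidelityGrowthWindow` (S) · `stub_gramSchurBound` (M) · `stub_weylParseval` (M) · `stub_parabolaSum` (M) ·
`stub_chirpInjectiveNorm` (L; uses the three previous ones).  Non-stub theorems of this file (land with the skeleton):
`not_fidelityGrowthAt_of_ge`, `robustnessGrowthWindow`, `chirpRank_of_robustnessGrowthAt`, `FidelityThesis_of`.
-/

namespace Summit.MatrixMultiplication.MatrixMultiplication.Theorems

open scoped BigOperators ComplexConjugate
open Literature.Computability.AlgebraicComplexity
open Summit.MatrixMultiplication.MatrixMultiplication.Theses.FidelityWitnesses (FidelityThesis DiagonalPowerDecay)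

/-! ## Stub 1 — the open node: n-free FIDELITY GROWTH -/

/-- **Stub — FIDELITY GROWTH (OPEN, XL; the load-bearing stub, the lead's).** Some `δ′ ∈ (0, 3/2)` and `C > 0` with
`M(n,r) ≤ C·r^{3/2−δ′}` for ALL `n, r`: `|⟨S,⟨n,n,n⟩⟩|² ≤ C r^{3/2−δ′} ‖S‖²` whenever `tensorRank S ≤ r`.
Calibration: true at exponent `3/2` with `C = 1` (`fidelity_le_rpow_threeHalves`, p94374) and at exponent `2`
(`fidelityGrowth_exponentTwo`); `M(n,r) ≥ r` (`r ≤ n³`, partial standard algorithm) and `M(m, R(⟨m,m,m⟩)) = m³`, so FG(δ′) forces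
`3/ω ≤ 3/2 − δ′`, i.e. `ω ≥ 2 + 4δ′/(3−2δ′)` (`stub_fidelityGrowthWindow`): it is at least the crux (⟺ ω > 2) and admits no
`δ′ ≥ 0.2358` (`not_fidelityGrowthAt_of_ge`).  Implied by ROBUSTNESS GROWTH (`fidelityGrowthAt_of_robustnessGrowthAt`, landed),
which is strictly stronger (`chirpRank_of_robustnessGrowthAt`).  On the diagonal `r = n²` it is the sibling crux
`DiagonalPowerDecay` (`diagonalPowerDecay_of_fidelityGrowth`, landed). -/
theorem stub_fidelityGrowth :
    ∃ δ' : ℝ, 0 < δ' ∧ δ' < 3 / 2 ∧ ∃ C : ℝ, 0 < C ∧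
      ∀ (n r : ℕ) (S : Fin n × Fin n → Fin n × Fin n → Fin n × Fin n → ℂ), tensorRank S ≤ r →
        ‖∑ a, ∑ b, ∑ c, S a b c * matMulTensor ℂ n n n a b c‖ ^ 2 ≤
          C * (r : ℝ) ^ (3 / 2 - δ') * ∑ a, ∑ b, ∑ c, ‖S a b c‖ ^ 2 := by
  sorry

/- **Stub — THE CONSTANT OF FIDELITY GROWTH IS NOT LOAD-BEARING (M/L; wave 2).** FG at `(δ′, C)` ⟹ FG at `(δ′, 1)`:
if `X := |⟨S,⟨n,n,n⟩⟩|² > r^{3/2−δ′}·‖S‖² =: ρY` for one `S` of rank `≤ r`, the Kronecker squares `S ⊠ S ⊠ …` (format `n^{2^j}`,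
rank `≤ r^{2^j}`, overlap `X^{2^{j-1}}…`, mass `Y^{2^j}`: rank is submultiplicative, overlap with `⟨n⟩⊠⟨n⟩ = ⟨n²⟩` and mass are
multiplicative) give `X^{2^j} ≤ C·(ρY)^{2^j}` for all `j`, impossible when `X/(ρY) > 1`.  So FG(δ′) is a pure exponent statement
`M(n,r) ≤ r^{3/2−δ′}` (and `sup_n M(n,r)` is supermultiplicative in `r`).  LANDED p101433 (`…StubFidelityGrowthConstOne.lean`, lead a1, imported; with `fidelityGrowthAt_iff_unitConstant`, `stub_fidelityGrowth_iff_pointwise`, `not_fidelityGrowthAt_of_equalityPoint`): -/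
-- theorem stub_fidelityGrowth_constOne {δ' C : ℝ} (hC : 0 < C)
--     (hFG : ∀ (n r : ℕ) (S : Fin n × Fin n → Fin n × Fin n → Fin n × Fin n → ℂ), tensorRank S ≤ r →
--       ‖∑ a, ∑ b, ∑ c, S a b c * matMulTensor ℂ n n n a b c‖ ^ 2 ≤
--         C * (r : ℝ) ^ (3 / 2 - δ') * ∑ a, ∑ b, ∑ c, ‖S a b c‖ ^ 2)
--     (n r : ℕ) (S : Fin n × Fin n → Fin n × Fin n → Fin n × Fin n → ℂ) (hS : tensorRank S ≤ r) :
--     ‖∑ a, ∑ b, ∑ c, S a b c * matMulTensor ℂ n n n a b c‖ ^ 2 ≤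
--       (r : ℝ) ^ (3 / 2 - δ') * ∑ a, ∑ b, ∑ c, ‖S a b c‖ ^ 2 := by
--   sorry

/-! ## Stub 2 — the T-free separable majorant law -/

/- **Stub — GENERAL (test-tensor-free) SEPARABLE MAJORANT LAW (M).** Index types arbitrary finite.  If the span of the `r`
products `u_l ⊗ v_l` is majorised by `λ·σ`, `σ = Σ_k p_k (φ_k⊗ψ_k)(φ_k⊗ψ_k)^*` a nonnegative sub-normalised separable mixture
(projector-free form `hmaj`, exactly the shape of lead -0's RG stub), and the test tensor `Z` has
`Σ_a |⟨f ⊗ g, Z_a⟩|² ≤ K‖f‖²‖g‖²` for all `f, g` (its injective norm² w.r.t. `ℓ²` on the output slot is `≤ K`), then every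
`S = Σ_l w_l ⊗ u_l ⊗ v_l` has `|⟨S, Z⟩|² ≤ λ·K·‖S‖²`.  Proof = the landed `stub_separableMajorantLaw` verbatim with
`sepMajorant_singleProductLaw` replaced by `hZ`: slice by slice `|Y_a|² ≤ λ N_a q_a`, weighted Cauchy–Schwarz over `a`
(`Finset.sum_sq_le_sum_mul_sum_of_sq_le_mul`), and `Σ_a q_a = Σ_k p_k Σ_a |⟨φ_k⊗ψ_k, Z_a⟩|² ≤ K·Σ_k p_k‖φ_k‖²‖ψ_k‖² ≤ K`.
LANDED p96754 (`…StubGeneralMajorantLaw.lean`, imported): -/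
-- theorem stub_generalMajorantLaw {α β γ : Type*} [Fintype α] [Fintype β] [Fintype γ] {r m : ℕ}
--     (w : Fin r → α → ℂ) (u : Fin r → β → ℂ) (v : Fin r → γ → ℂ)
--     (p : Fin m → ℝ) (φ : Fin m → β → ℂ) (ψ : Fin m → γ → ℂ) (lam K : ℝ) (hlam : 0 ≤ lam) (hK : 0 ≤ K)
--     (hp : ∀ k, 0 ≤ p k)
--     (htr : ∑ k, p k * ((∑ b, ‖φ k b‖ ^ 2) * ∑ c, ‖ψ k c‖ ^ 2) ≤ 1)
--     (hmaj : ∀ (d : Fin r → ℂ) (z : β → γ → ℂ),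
--       ‖∑ b, ∑ c, (∑ l, d l * u l b * v l c) * z b c‖ ^ 2 ≤
--         lam * (∑ b, ∑ c, ‖∑ l, d l * u l b * v l c‖ ^ 2) *
--           ∑ k, p k * ‖∑ b, ∑ c, φ k b * ψ k c * z b c‖ ^ 2)
--     (Z : α → β → γ → ℂ)
--     (hZ : ∀ (f : β → ℂ) (g : γ → ℂ),
--       ∑ a, ‖∑ b, ∑ c, f b * g c * Z a b c‖ ^ 2 ≤ K * ((∑ b, ‖f b‖ ^ 2) * ∑ c, ‖g c‖ ^ 2)) :
--     ‖∑ a, ∑ b, ∑ c, (∑ l, w l a * u l b * v l c) * Z a b c‖ ^ 2 ≤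
--       lam * K * ∑ a, ∑ b, ∑ c, ‖∑ l, w l a * u l b * v l c‖ ^ 2 := by
--   sorry

/-! ## Stub 3 — the exponent window of fidelity growth -/

/- **Stub — FIDELITY GROWTH WINDOW (S).** FG at `(δ′, C)` (with `δ′ < 3/2`, `C > 0`) forces `2 + 4δ′/(3−2δ′) ≤ ω(ℂ)`:
the landed transfer `fidelityThesis_curve_of_fidelityGrowthAt` turns FG into the crux's gap inequality along the curve
`r ≤ c·n^{2+δ}`, `δ = 4δ′/(3−2δ′)`, `c = (1/(2C))^{1/(3/2−δ′)} > 0`, and the landed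
`fidelityThesis_le_omega_of_curve` (`Theorems/FidelityThesis/Negative/SummitEquivalence`) turns that into `2 + δ ≤ ω(ℂ)`.
Two lines.  LANDED p96544 (`…StubFidelityGrowthWindow.lean`, imported, with `not_fidelityGrowthAt_of_ge` — no FG at any
`δ′ ≥ 0.2358` — and the RG versions `robustnessGrowthWindow`, `not_robustnessGrowthAt_of_ge`): -/
-- theorem stub_fidelityGrowthWindow {δ' C : ℝ} (hδ'1 : δ' < 3 / 2) (hC : 0 < C)
--     (hFG : ∀ (n r : ℕ) (S : Fin n × Fin n → Fin n × Fin n → Fin n × Fin n → ℂ), tensorRank S ≤ r →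
--       ‖∑ a, ∑ b, ∑ c, S a b c * matMulTensor ℂ n n n a b c‖ ^ 2 ≤
--         C * (r : ℝ) ^ (3 / 2 - δ') * ∑ a, ∑ b, ∑ c, ‖S a b c‖ ^ 2) :
--     2 + 4 * δ' / (3 - 2 * δ') ≤ omega ℂ := by
--   sorry

-- `not_fidelityGrowthAt_of_ge`, `robustnessGrowthWindow`, `not_robustnessGrowthAt_of_ge`: LANDED with the window stub (p96544).

/-! ## Stubs 4–7 — the chirp tensors: an explicit family on which RG predicts superlinear rank

`Z_N(k, b, c) = [b = c + k]·e(k²c)` on `ℤ/N` (`e = ZMod.stdAddChar`, `N` an odd prime): output slices are the `N` unitaries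
`Z^{k²}X^k` (one from each non-vertical line of the Weyl–Heisenberg group), `‖Z_N‖² = N²`, and the injective norm²
`sup_{f,g} Σ_k |⟨f ⊗ g, (Z_N)_k⟩|²` is `≤ √(2N−1)` (stubs 4–7), so `Λ(R(Z_N)) ≥ ‖Z_N‖⁴/(‖Z_N‖²·√(2N−1)) ≥ N^{3/2}/√2`. -/

/- **Stub — GRAM–SCHUR BOUND (M, pure linear algebra).** For a finite family of vectors `x_k` and any `χ`:
`Σ_k |Σ_b χ_b x_k(b)|² ≤ ‖G‖_F · ‖χ‖²`, `G_{kk′} = Σ_b conj(x_k b)·x_{k′} b` the Gram matrix.  Proof: with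
`c_k = Σ_b χ_b x_k(b)`, `Σ_k |c_k|² = Σ_b χ_b y_b` for `y = Σ_k conj(c_k) x_k`, so `(Σ|c_k|²)² ≤ ‖χ‖²‖y‖²`, and
`‖y‖² = |Σ_{kk′} conj(c_k) c_{k′} conj(G_{kk′})| ≤ ‖c‖²·‖G‖_F` (Cauchy–Schwarz on `α × α`); divide by `‖c‖² = Σ|c_k|²`.
LANDED p97607 (`…StubGramSchurBound.lean`, imported): -/
-- theorem stub_gramSchurBound {α β : Type*} [Fintype α] [Fintype β] (x : α → β → ℂ) (χ : β → ℂ) :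
--     ∑ k, ‖∑ b, χ b * x k b‖ ^ 2 ≤
--       Real.sqrt (∑ k, ∑ k', ‖∑ b, conj (x k b) * x k' b‖ ^ 2) * ∑ b, ‖χ b‖ ^ 2 := by
--   sorry

/- **Stub — WEYL–PARSEVAL on `ℤ/N` (M).** The ambiguity function `A_ψ(s,t) = Σ_b conj(ψ b)·ψ(b − s)·e(t b)`
(`e = ZMod.stdAddChar`) has `Σ_{s,t} |A_ψ(s,t)|² = N·‖ψ‖⁴`: for fixed `s`, `t ↦ A_ψ(s,t)` is the Fourier transform of
`b ↦ conj(ψ b)ψ(b−s)`, Plancherel (`AddChar.sum_mulShift` with `ZMod.isPrimitive_stdAddChar`, `map_neg_eq_inv`,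
`Circle.coe_inv_eq_conj`) gives `Σ_t |A(s,t)|² = N Σ_b |ψ b|²|ψ(b−s)|²`, and `Σ_s Σ_b |ψ b|²|ψ (b−s)|² = ‖ψ‖⁴`
(reindex `s ↦ b − s`).  LANDED p98547 (`…StubWeylParseval.lean`, imported): -/
-- theorem stub_weylParseval {N : ℕ} [NeZero N] (ψ : ZMod N → ℂ) :
--     ∑ s : ZMod N, ∑ t : ZMod N,
--         ‖∑ b : ZMod N, conj (ψ b) * ψ (b - s) * (ZMod.stdAddChar (t * b) : ℂ)‖ ^ 2 =
--       (N : ℝ) * (∑ b, ‖ψ b‖ ^ 2) ^ 2 := by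
--   sorry

/- **Stub — PARABOLA SUM (M, combinatorics in `𝔽_N`, `N` an odd prime).** `(k, k′) ↦ (k′ − k, k′² − k²)` is a bijection
from `{k ≠ k′}` onto `{(s,t) : s ≠ 0}` (inverse `k = (t/s − s)/2`, `k′ = (t/s + s)/2`; needs `2 ≠ 0`), and the diagonal
`k = k′` contributes `N` copies of `F 0 0`.  Hence `Σ_{k,k′} F(k′−k, k′²−k²) = N·F(0,0) + Σ_{s≠0} Σ_t F(s,t)`.
LANDED p99712 (`…StubParabolaSum.lean`, imported): -/
-- theorem stub_parabolaSum {N : ℕ} [Fact (Nat.Prime N)] (hN : N ≠ 2) (F : ZMod N → ZMod N → ℝ) :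
--     ∑ k : ZMod N, ∑ k' : ZMod N, F (k' - k) (k' ^ 2 - k ^ 2) =
--       (N : ℝ) * F 0 0 + ∑ s ∈ (Finset.univ : Finset (ZMod N)).erase 0, ∑ t : ZMod N, F s t := by
--   sorry

/- **Stub — CHIRP INJECTIVE NORM (L).** For `N` an odd prime and all `f, g : ℤ/N → ℂ`:
`Σ_k |Σ_{b,c} f b · g c · [b = c + k] e(k² c)|² ≤ √(2N−1)·‖f‖²·‖g‖²`.  Proof: `Σ_{b,c} … = Σ_b f b · x_k(b)` with
`x_k(b) = g(b − k)·e(k²(b − k))`; `stub_gramSchurBound` bounds the left side by `‖G‖_F‖f‖²`, where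
`|G_{kk′}| = |A_g(k′−k, k′²−k²)|` (substitute `b ↦ b + k`; `A_g` as in `stub_weylParseval`, unimodular factors drop);
`stub_parabolaSum` with `F s t = |A_g(s,t)|²` and `stub_weylParseval` give
`‖G‖_F² = N|A_g(0,0)|² + Σ_{s≠0,t}|A_g|² ≤ N‖g‖⁴ + (N‖g‖⁴ − |A_g(0,0)|²) = (2N−1)‖g‖⁴` (`A_g(0,0) = ‖g‖²`).  LANDED (`…StubChirpInjectiveNorm.lean`, lead -1, imported): -/
-- theorem stub_chirpInjectiveNorm {N : ℕ} [Fact (Nat.Prime N)] (hN : N ≠ 2) (f g : ZMod N → ℂ) :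
--     ∑ k : ZMod N, ‖∑ b : ZMod N, ∑ c : ZMod N,
--         f b * g c * (if b = c + k then (ZMod.stdAddChar (k ^ 2 * c) : ℂ) else 0)‖ ^ 2 ≤
--       Real.sqrt (2 * N - 1) * ((∑ b, ‖f b‖ ^ 2) * ∑ c, ‖g c‖ ^ 2) := by
--   sorry

/-! ## RG on the chirp tensors: superlinear rank — `chirpRank_of_robustnessGrowthAt`
LANDED by lead -1 in `Theorems/FidelityWitnessesFidelityThesisChirpRank.lean` (with the border-rank version):
RG(δ′, C) ⟹ `N^{3/2}/(√2·C) ≤ R(Z_N)^{3/2−δ′}` for every odd prime `N`.  Numerics (lead a1, `ChirpNumerics-a1.md`, kit j017116):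
`Z_N` is rank-GENERIC at `N = 3, 5, 7` (ranks 5, 10, 19), `K(Z_N) ≍ N^{1/3}` — the family documents RG's strength, it refutes nothing. -/

/-! ## Budget bookkeeping of the open stub (leads a1, c2)
* `stub_fidelityGrowth_iff_dpd_and_smallBudget` (a1, p103097, imported): FG ⟺ DiagonalPowerDecay ∧ FG|_{r < n²}.
* `fidelityGrowth_iff_thinBudget` (c2, `…SepMajorantThinBudget.lean`): FG ⟺ FG|_{r < n} — zero-padding makes every budget
  thin, so the restriction is no weakening and FG|_{r<n} alone ⟹ DPD ⟹ crux; the open content is exactly the localisation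
  question "can `r` products capture more than `C r^{3/2−δ′}` of `⟨n,n,n⟩` when `n ≫ r`?" (n-free profile `sup_n M(n,r)`). -/

/-! ## Calibration: the majorant shape at exponent 2 (lead -0, kept) -/

/-- **`M(n,r) ≤ r²` for all `n, r`** (fidelity growth at exponent `2 = 3/2 − (−½)`, constant `1`): the trivial majorant
(`stub_trivialMajorant`) fed to `fidelityGrowthAt_of_robustnessGrowthAt`.  Content-free for the crux (the flattening
witness `n·r` is better for `r ≥ n`), but it certifies that the `∃`-majorant shape of RG is inhabited uniformly in `n`. -/
theorem fidelityGrowth_exponentTwo (n r : ℕ) (S : Fin n × Fin n → Fin n × Fin n → Fin n × Fin n → ℂ)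
    (hS : tensorRank S ≤ r) :
    ‖∑ a, ∑ b, ∑ c, S a b c * matMulTensor ℂ n n n a b c‖ ^ 2 ≤
      1 * (r : ℝ) ^ (3 / 2 - (-1 / 2 : ℝ)) * ∑ a, ∑ b, ∑ c, ‖S a b c‖ ^ 2 := by
  refine fidelityGrowthAt_of_robustnessGrowthAt one_pos (fun n r u v => ?_) n r S hS
  obtain ⟨m, p, φ, ψ, lam, h0, hle, hp, htr, hmaj⟩ := stub_trivialMajorant u v
  refine ⟨m, p, φ, ψ, lam, h0, ?_, hp, htr, hmaj⟩
  have h2 : (3 / 2 - (-1 / 2 : ℝ)) = ((2 : ℕ) : ℝ) := by norm_num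
  rw [h2, Real.rpow_natCast, one_mul]
  exact hle

/-! ## Status certificates (cycle 3; everything invoked here is LANDED — these lines are name-resolution and bookkeeping) -/

/-- The crux is EXACTLY `2 < ω(ℂ)` (landed `two_lt_omega_of_fidelityThesis` / `omega_le_two_of_not_fidelityThesis`,
`Theorems/FidelityThesis/Negative/SummitEquivalence`, p83600). -/
theorem lineSketch_crux_iff_two_lt_omega : FidelityThesis ↔ 2 < omega ℂ :=
  ⟨two_lt_omega_of_fidelityThesis, fun h => by_contra fun hX => absurd (omega_le_two_of_not_fidelityThesis hX) (not_le.2 h)⟩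

/-- The open stub, at whatever `(δ′, C)` it holds, forces `2 + 4δ′/(3−2δ′) ≤ ω(ℂ)` (landed window p96544): every admissible
instance of `stub_fidelityGrowth` is at least the crux. -/
theorem lineSketch_stub_window : ∃ δ' : ℝ, 0 < δ' ∧ 2 + 4 * δ' / (3 - 2 * δ') ≤ omega ℂ := by
  obtain ⟨δ', h0, h1, C, hC, h⟩ := stub_fidelityGrowth
  exact ⟨δ', h0, stub_fidelityGrowthWindow h1 hC h⟩

/-- The open stub implies the sibling crux item `DiagonalPowerDecay` (stmt-MatrixMultiplication-14053; landed transfer p92236),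
and is equivalent to `DiagonalPowerDecay ∧` its small-budget restriction (lead a1, p103097). -/
theorem lineSketch_stub_dpd : DiagonalPowerDecay :=
  (stub_fidelityGrowth_iff_dpd_and_smallBudget.1 stub_fidelityGrowth).1

/-- The constant is not load-bearing (lead a1, p101433): the stub at `(δ′, C)` gives the stub at `(δ′, 1)`. -/
theorem lineSketch_stub_constOne : ∃ δ' : ℝ, 0 < δ' ∧ δ' < 3 / 2 ∧
    ∀ (n r : ℕ) (S : Fin n × Fin n → Fin n × Fin n → Fin n × Fin n → ℂ), tensorRank S ≤ r →
      ‖∑ a, ∑ b, ∑ c, S a b c * matMulTensor ℂ n n n a b c‖ ^ 2 ≤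
        (r : ℝ) ^ (3 / 2 - δ') * ∑ a, ∑ b, ∑ c, ‖S a b c‖ ^ 2 := by
  obtain ⟨δ', h0, h1, C, hC, h⟩ := stub_fidelityGrowth
  exact ⟨δ', h0, h1, fun n r S hS => stub_fidelityGrowth_constOne hC h n r S hS⟩

/-- FG at the CRITICAL exponent is a theorem (p94374): `M(n,r) ≤ r^{3/2}` for all `n, r` — the stub asks for any power saving
below it, uniformly in `n`. -/
theorem lineSketch_threeHalves (n r : ℕ) (S : Fin n × Fin n → Fin n × Fin n → Fin n × Fin n → ℂ)
    (hS : tensorRank S ≤ r) :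
    ‖∑ a, ∑ b, ∑ c, S a b c * matMulTensor ℂ n n n a b c‖ ^ 2 ≤
      (r : ℝ) ^ (3 / 2 : ℝ) * ∑ a, ∑ b, ∑ c, ‖S a b c‖ ^ 2 :=
  fidelity_le_rpow_threeHalves n r S hS

/-! ## The composition -/

/-- **`FidelityThesis_of` — the line's kernel-checked composition (modulo the one registered open stub).**
n-free FIDELITY GROWTH (`stub_fidelityGrowth`) ⇒ the crux (`fidelityThesis_of_fidelityGrowth`, landed p92236:
`δ = 4δ′/(3−2δ′)`, `c = (1/(2C))^{1/(3/2−δ′)}`, `ε = ½`). -/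
theorem FidelityThesis_of : FidelityThesis :=
  fidelityThesis_of_fidelityGrowth stub_fidelityGrowth

end Summit.MatrixMultiplication.MatrixMultiplication.Theorems
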